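import Summits.PneNP.PneNP.Theses.ConvexRankGates
import Literature.Computability.Complexity.ExtMonotoneCircuits
import Literature.Computability.Complexity.CircuitComposition
import Literature.Barriers.PneNP.MonotoneGapHolds
import Summits.PneNP.PneNP.Theorems.Capture.Negative.BoundedFanIn

/-!
# `Capture` (stmt-PneNP-2659, route PneNP/ConvexRankGates) — negative-side lemmas: load-bearing hypotheses

Standing-adversary (cdisprove, gen 2) output for the crux
`Summit.PneNP.PneNP.Theses.ConvexRankGates.Capture`
(`∃ a, ∀ finite ι, ∀ MONOTONE f, ∀ B₂-circuit C for f, ∃ C' over B_N = {∧₂,∨₂} ∪ CONV_N ∪ PERM_N ∪ GRANK_N`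
`with ≤ N = (|C| + |ι| + 2)^a gates computing f`). The crux is NOT refuted and NOT mis-stated (its negation
is a super-polynomial lower bound against circuits with LP/SDP, permutation-group and generic-rank gates,
open even for one weak LP gate, Oliveira–Pudlák 2019 p. 3). This file records, as theorems, which parts of
it any proof must use:

* §0 `capture_iff` — the inline gate class IS `extGate`; `CaptureInto B` = the crux with target basis
  family `B` (the crux is `CaptureInto extGate`), monotone in `B`.
* §1 `capture_false_without_Monotone` — `Monotone f` is load-bearing (`x ↦ ¬x₀`; the basis is monotone by
  syntax, `Circuit.not_computes_bnot_of_isOver_extGate`). Stated inline (no named `Prop`).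
* §2 `not_captureByMonotoneBasis` — the wide gates are load-bearing: `CaptureInto (fun _ => monotoneBasis)`
  would be a polynomial monotone-to-general transfer, refuted by the tree's proved Tardos gap
  (`Literature.Barriers.PneNP.not_monotoneTransfer_pow_holds`); `not_captureInto_boundedFanIn` restates the
  accepted `BoundedFanIn.lean` refutation in the same shape.

Companions: `BoundedFanIn.lean` (the strengthening "wide gates of bounded fan-in" is false for every
bound), `GateLocality.lean` (PERM order obstruction; GRANK and PERM gates are local). Crux work file:
`Cruxes/Capture/Disproof.lean`. Refuter seat cdisprove-stmt-PneNP-2659-g2, 2026-08-16.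
-/

namespace Summit.PneNP.PneNP.Theorems.Capture.Negative

open Literature.Computability.Complexity Literature.Barriers.PneNP Filter Finset
open Summit.PneNP.PneNP.Theses.ConvexRankGates (Capture)

/-! ## §0 Read-back: the inline `let Ext` of the crux is the Literature's `extGate` -/

/-- `Capture` with an arbitrary target basis family `B : ℕ → Set GateFn` and size budget: the common
shape of the crux (`B = extGate`) and of the strengthenings / mutations below. [folklore] -/
def CaptureInto (B : ℕ → Set GateFn) : Prop :=
  ∃ a : ℕ, ∀ (ι : Type) (_ : Fintype ι) (f : (ι → Bool) → Bool), Monotone f →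
    ∀ C : Circuit ι, C.IsOver B2 → C.Computes f →
      ∃ C' : Circuit ι, C'.IsOver (B ((C.size + Fintype.card ι + 2) ^ a)) ∧
        C'.size ≤ (C.size + Fintype.card ι + 2) ^ a ∧ C'.Computes f

/-- The inline gate class of the crux is `extGate s` (definitional up to `mem_extGate_iff`). [folklore] -/
theorem inlineExt_eq_extGate (s : ℕ) :
    ({g : GateFn | g = GateFn.and 2 ∨ g = GateFn.or 2 ∨ IsConvGate s g ∨ IsPermGate s g ∨
      IsGRankGate s g}) = extGate s := by
  ext g; rw [mem_extGate_iff]; rfl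

/-- **Read-back.** The crux `Capture` is `CaptureInto extGate`: every monotone `f` with a `B₂`-circuit of
size `t` on `n = |ι|` inputs has a circuit over `B_N = {∧₂,∨₂} ∪ CONV_N ∪ PERM_N ∪ GRANK_N` with at most
`N = (t+n+2)^a` gates, for one absolute exponent `a`. [folklore] -/
theorem capture_iff : Capture ↔ CaptureInto extGate := by
  unfold Capture CaptureInto
  simp only []
  constructor
  · rintro ⟨a, h⟩
    refine ⟨a, fun ι _ f hf C hB hC => ?_⟩
    obtain ⟨C', h1, h2, h3⟩ := h ι _ f hf C hB hC
    refine ⟨C', ?_, h2, h3⟩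
    rw [← inlineExt_eq_extGate]
    exact h1
  · rintro ⟨a, h⟩
    refine ⟨a, fun ι _ f hf C hB hC => ?_⟩
    obtain ⟨C', h1, h2, h3⟩ := h ι _ f hf C hB hC
    refine ⟨C', ?_, h2, h3⟩
    rw [← inlineExt_eq_extGate] at h1
    exact h1

/-- `CaptureInto` is monotone in the target basis family. [folklore] -/
theorem CaptureInto.mono {B B' : ℕ → Set GateFn} (h : CaptureInto B) (hBB' : ∀ s, B s ⊆ B' s) :
    CaptureInto B' := by
  obtain ⟨a, h⟩ := h
  refine ⟨a, fun ι _ f hf C hB hC => ?_⟩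
  obtain ⟨C', h1, h2, h3⟩ := h ι _ f hf C hB hC
  exact ⟨C', h1.mono (hBB' _), h2, h3⟩

/-! ## §1 The hypothesis `Monotone f` is load-bearing -/

/-- **Any proof of `Capture` must use `Monotone f`.** With that hypothesis DROPPED the statement is
false: `x ↦ ¬x₀` has a `B₂`-circuit of size `1`, but every circuit over every `B_s`, of any size, computes
a monotone function (`Circuit.not_computes_bnot_of_isOver_extGate`: the extended basis is monotone BY
SYNTAX). [folklore] -/
theorem capture_false_without_Monotone :
    ¬ ∃ a : ℕ, ∀ (ι : Type) (_ : Fintype ι) (f : (ι → Bool) → Bool),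
      ∀ C : Circuit ι, C.IsOver B2 → C.Computes f →
        ∃ C' : Circuit ι, C'.IsOver (extGate ((C.size + Fintype.card ι + 2) ^ a)) ∧
          C'.size ≤ (C.size + Fintype.card ι + 2) ^ a ∧ C'.Computes f := by
  rintro ⟨a, h⟩
  obtain ⟨C, hB, -, hC⟩ := (cktSize_not (ι := Fin 1) (0 : Fin 1)).toCircuit
  obtain ⟨C', h1, -, h3⟩ := h (Fin 1) inferInstance (fun x => !(x 0)) C hB (fun x => hC x)
  exact C'.not_computes_bnot_of_isOver_extGate h1 0 h3

/-! ## §2 The wide gates are load-bearing: capture by `{∧₂, ∨₂}` alone is FALSE (Tardos gap) -/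

/-- Size bookkeeping: `t + v² + 2 ≤ (v + t)³` for `v ≥ 2`. [folklore] -/
theorem size_bookkeeping {v t : ℕ} (hv : 2 ≤ v) : t + v ^ 2 + 2 ≤ (v + t) ^ 3 := by
  have h1 : v ^ 2 + 2 ≤ v ^ 3 := by nlinarith
  have h2 : v ^ 3 + t ≤ (v + t) ^ 3 := by
    have h3 : 1 ≤ 3 * v ^ 2 + 3 * v * t + t ^ 2 := by nlinarith
    calc v ^ 3 + t = v ^ 3 + t * 1 := by ring
      _ ≤ v ^ 3 + t * (3 * v ^ 2 + 3 * v * t + t ^ 2) := by gcongr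
      _ = (v + t) ^ 3 := by ring
  omega

/-- **STRENGTHENING S₁ — capture WITHOUT wide gates (simulating circuit over the plain monotone basis
`{∧₂, ∨₂}`) is FALSE**: it would be a polynomial monotone-to-general transfer `(v + t)^{3a}`, refuted by
the tree's PROVED Tardos gap (`Literature.Barriers.PneNP.not_monotoneTransfer_pow_holds`: Tardos 1988 /
Jukna 2012 Thm. 9.28, via Alon–Boppana and the GLS theta machine). So any proof of `Capture` must route
some function through a CONV, PERM or GRANK gate. [folklore] -/
theorem not_captureByMonotoneBasis : ¬ CaptureInto fun _ => monotoneBasis := by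
  rintro ⟨a, h⟩
  refine not_monotoneTransfer_pow_holds (3 * a) ?_
  filter_upwards [eventually_ge_atTop 2] with v hv f hf C hB hC
  obtain ⟨C', h1, h2, h3⟩ := h _ inferInstance f hf C (hB.mono deMorganBasis_subset_B2) hC
  calc circuitSizeOver monotoneBasis f ≤ C'.size := circuitSizeOver_le_of_computes C' h1 h3
    _ ≤ (C.size + Fintype.card ((⊤ : SimpleGraph (Fin v)).edgeSet) + 2) ^ a := h2
    _ ≤ ((v + C.size) ^ 3) ^ a := by
        apply Nat.pow_le_pow_left
        have := card_edgeSet_top_le' v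
        have := size_bookkeeping (t := C.size) hv
        omega
    _ = (v + C.size) ^ (3 * a) := by rw [← pow_mul]

/-- Equivalently: `Capture` into ANY basis family contained in `{∧₂,∨₂}` is false; in particular the
wide part `CONV ∪ PERM ∪ GRANK` of `extGate` cannot be dropped. [folklore] -/
theorem not_captureInto_of_subset_monotoneBasis {B : ℕ → Set GateFn} (hB : ∀ s, B s ⊆ monotoneBasis) :
    ¬ CaptureInto B := fun h => not_captureByMonotoneBasis (h.mono hB)

/-- Conversely the accepted `BoundedFanIn.not_captureBoundedFanIn` in `CaptureInto` form: wide gates of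
bounded fan-in do not help either. [folklore] -/
theorem not_captureInto_boundedFanIn (k : ℕ) : ¬ CaptureInto fun N => extGate N ∩ {g | g.1 ≤ k} :=
  not_captureBoundedFanIn k

end Summit.PneNP.PneNP.Theorems.Capture.Negative
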